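import Summits.CriticalPhenomena.PercolationContinuityZ3.Theorems.Transplant.Bcc111SKc40U
import Summits.CriticalPhenomena.PercolationContinuityZ3.Theorems.Transplant.Bcc111SKc40T00
import Summits.CriticalPhenomena.PercolationContinuityZ3.Theorems.Transplant.Bcc111SKc40T0p
import Summits.CriticalPhenomena.PercolationContinuityZ3.Theorems.Transplant.Bcc111SKc40T11
import Summits.CriticalPhenomena.PercolationContinuityZ3.Theorems.Transplant.Bcc111SKc40T1p
import Summits.CriticalPhenomena.PercolationContinuityZ3.Theorems.Transplant.Bcc111SKc40T22
import Summits.CriticalPhenomena.PercolationContinuityZ3.Theorems.Transplant.Bcc111SKc40T2p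
import Summits.CriticalPhenomena.PercolationContinuityZ3.Theorems.Transplant.Bcc111SKc40S00
import Summits.CriticalPhenomena.PercolationContinuityZ3.Theorems.Transplant.Bcc111SKc40S0p
import Summits.CriticalPhenomena.PercolationContinuityZ3.Theorems.Transplant.Bcc111SKc40S11
import Summits.CriticalPhenomena.PercolationContinuityZ3.Theorems.Transplant.Bcc111SKc40S1p
import Summits.CriticalPhenomena.PercolationContinuityZ3.Theorems.Transplant.Bcc111SKc40S22
import Summits.CriticalPhenomena.PercolationContinuityZ3.Theorems.Transplant.Bcc111SKc40S2p
import Summits.CriticalPhenomena.PercolationContinuityZ3.Theorems.Transplant.Bcc111SKc41U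
import Summits.CriticalPhenomena.PercolationContinuityZ3.Theorems.Transplant.Bcc111SKc41T00
import Summits.CriticalPhenomena.PercolationContinuityZ3.Theorems.Transplant.Bcc111SKc41T0p
import Summits.CriticalPhenomena.PercolationContinuityZ3.Theorems.Transplant.Bcc111SKc41T11
import Summits.CriticalPhenomena.PercolationContinuityZ3.Theorems.Transplant.Bcc111SKc41T1p
import Summits.CriticalPhenomena.PercolationContinuityZ3.Theorems.Transplant.Bcc111SKc41T22
import Summits.CriticalPhenomena.PercolationContinuityZ3.Theorems.Transplant.Bcc111SKc41T2p
import Summits.CriticalPhenomena.PercolationContinuityZ3.Theorems.Transplant.Bcc111SKc41S00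
import Summits.CriticalPhenomena.PercolationContinuityZ3.Theorems.Transplant.Bcc111SKc41S0p
import Summits.CriticalPhenomena.PercolationContinuityZ3.Theorems.Transplant.Bcc111SKc41S11
import Summits.CriticalPhenomena.PercolationContinuityZ3.Theorems.Transplant.Bcc111SKc41S1p
import Summits.CriticalPhenomena.PercolationContinuityZ3.Theorems.Transplant.Bcc111SKc41S22
import Summits.CriticalPhenomena.PercolationContinuityZ3.Theorems.Transplant.Bcc111SKc41S2p
import Summits.CriticalPhenomena.PercolationContinuityZ3.Theorems.Transplant.Bcc111SKc42U
import Summits.CriticalPhenomena.PercolationContinuityZ3.Theorems.Transplant.Bcc111SKc42T00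
import Summits.CriticalPhenomena.PercolationContinuityZ3.Theorems.Transplant.Bcc111SKc42T0p
import Summits.CriticalPhenomena.PercolationContinuityZ3.Theorems.Transplant.Bcc111SKc42T11
import Summits.CriticalPhenomena.PercolationContinuityZ3.Theorems.Transplant.Bcc111SKc42T1p
import Summits.CriticalPhenomena.PercolationContinuityZ3.Theorems.Transplant.Bcc111SKc42T22
import Summits.CriticalPhenomena.PercolationContinuityZ3.Theorems.Transplant.Bcc111SKc42T2p
import Summits.CriticalPhenomena.PercolationContinuityZ3.Theorems.Transplant.Bcc111SKc42S00
import Summits.CriticalPhenomena.PercolationContinuityZ3.Theorems.Transplant.Bcc111SKc42S0p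
import Summits.CriticalPhenomena.PercolationContinuityZ3.Theorems.Transplant.Bcc111SKc42S11
import Summits.CriticalPhenomena.PercolationContinuityZ3.Theorems.Transplant.Bcc111SKc42S1p
import Summits.CriticalPhenomena.PercolationContinuityZ3.Theorems.Transplant.Bcc111SKc42S22
import Summits.CriticalPhenomena.PercolationContinuityZ3.Theorems.Transplant.Bcc111SKc42S2p
import Summits.CriticalPhenomena.PercolationContinuityZ3.Theorems.Transplant.Bcc111FilmLifts
import HarnessLib

/-!
# The bcc (111)-films at small thickness — ASSEMBLY for `m = 4`: `(Bcc111.hexShadow 4).ShapedLinkageX 3` by kernel certificates, and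
# **`θ_{F_4(bcc)}(v, p_c(F_4(bcc))) = 0` for every vertex** — UNCONDITIONAL, p205010-free

builds on p205010 (kernel theorem, internal audit signed; external expert review pending) — NOT used in this file or anywhere in this chain.
Lane `prim-bschramm`, seat `prim-bschramm-p2` (gen 49; class C1b = films / other 3D lattices at their own critical point, METHOD = input substitution; memo
`HOME/bschramm/P2-LATTICES.md` §160); helper file (`--supports stmt-CriticalPhenomena-4575 --as helper`).
«Bcc111FilmLifts».`Bcc111.theta_criticalProb_eq_zero_of_shapedLinkageX` reduced `θ(p_c) = 0` on the bcc (111)-film `F_m(bcc) = bcc ∩ {0 ≤ x₀+x₁+x₂ ≤ m}`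
(`m ≥ 3`) to the exit-form routing certificate `ShapedLinkageX R` of «HexShadowVRouteDataX»; «Bcc111Route5» discharged it for `m ≥ 5` by the elevator-hub template.
At `m = 4` the template's lifts do not exist and the certificate is EXPLICIT: for every block centre `z` (three centre classes) and all node parameters (13 block
shapes: unclipped, `t`-clipped `t_R ∈ {0,1,2}` with `t_D = t_R` or `t_D > t_R`, `s`-clipped likewise) the kernel-certified case «Bcc111SKc4··» supplies the
cleared set and the swap pairs («Bcc111SKCase».`linkageX_of_caseOK`):
**`Bcc111.shapedLinkageX_three_m4`**, hence **`Bcc111.theta_criticalProb_eq_zero_m4`**.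
[cite: DuminilCopinSidoraviciusTassion2016, Thm. 1, §2.3 (proof of Fact 2)] [cite: BenjaminiSchramm1996, Conj. 4 / Question 3] [cite: ConwaySloane1999, Ch. 4 §7.1]
-/

noncomputable section

namespace Summit.CriticalPhenomena.PercolationContinuityZ3.Theorems.Transplant

open Literature.Probability.Percolation Literature.Probability.LatticeModels SimpleGraph
open scoped Classical

namespace Bcc111.SK

/-- The exit-form node clause at every block of centre class `0` of `F_4(bcc)`, by block shape (13 covered cases). [cite: DuminilCopinSidoraviciusTassion2016, §2.3 (proof of Fact 2)] -/
theorem linkageX_4_0 (z : Site 2) (hz : (3 : ℤ) ∣ z 0 + 2 * z 1 - ((0 : ℕ) : ℤ)) (tR tD sR sD : ℕ) (htD : tR ≤ tD) (hsD : sR ≤ sD)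
    (hone : 3 ≤ tR ∨ 3 ≤ sR) :
    ∃ W : Set (bfilm 4), (∀ x ∈ W, (Bcc111.hexShadow 4).sh x ∈ blkR 3 z tD sD) ∧
      (∀ x, (Bcc111.hexShadow 4).sh x ∈ hexBall z 1 → (Bcc111.hexShadow 4).sh x ∈ blkR 3 z tD sD → x ∈ W) ∧
        ∀ (E₁ E₂ w' : bfilm 4), (Bcc111.hexShadow 4).TerminalsX 3 z tR tD sR sD W E₁ E₂ w' →
          ∃ r₁ r₂ : VRouteData (Bcc111.film 4) (W ∩ (Bcc111.hexShadow 4).lift (blkR 3 z tR sR)) W E₁ E₂ w', r₁.y = r₂.b ∧ r₁.b = r₂.y := by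
  rcases Nat.lt_or_ge tR 3 with htR3 | htR3
  · have hsR3 : 3 ≤ sR := by omega
    interval_cases tR
    · rcases Nat.lt_or_ge tD 1 with htD1 | htD1
      · exact ⟨_, linkageX_of_caseOK caseOK_4_0_T00 (by decide) hz (by change (0:ℕ) = min 0 3; rfl) (by change (3:ℕ) = min sR 3; omega) (Or.inl (by change tD ≤ 0; omega)) (Or.inr (by decide)) (Or.inr (by decide)) (t1 := 0) (s1 := 3) (by omega) (by omega) (Or.inl (by omega)) (Or.inr (by norm_num)) wOK_4_0_T00⟩
      · exact ⟨_, linkageX_of_caseOK caseOK_4_0_T0p (by decide) hz (by change (0:ℕ) = min 0 3; rfl) (by change (3:ℕ) = min sR 3; omega) (Or.inr (by decide)) (Or.inr (by decide)) (Or.inr (by decide)) (t1 := 1) (s1 := 3) (by omega) (by omega) (Or.inr (by norm_num)) (Or.inr (by norm_num)) wOK_4_0_T0p⟩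
    · rcases Nat.lt_or_ge tD 2 with htD1 | htD1
      · exact ⟨_, linkageX_of_caseOK caseOK_4_0_T11 (by decide) hz (by change (1:ℕ) = min 1 3; rfl) (by change (3:ℕ) = min sR 3; omega) (Or.inl (by change tD ≤ 1; omega)) (Or.inr (by decide)) (Or.inr (by decide)) (t1 := 1) (s1 := 3) (by omega) (by omega) (Or.inl (by omega)) (Or.inr (by norm_num)) wOK_4_0_T11⟩
      · exact ⟨_, linkageX_of_caseOK caseOK_4_0_T1p (by decide) hz (by change (1:ℕ) = min 1 3; rfl) (by change (3:ℕ) = min sR 3; omega) (Or.inr (by decide)) (Or.inr (by decide)) (Or.inr (by decide)) (t1 := 2) (s1 := 3) (by omega) (by omega) (Or.inr (by norm_num)) (Or.inr (by norm_num)) wOK_4_0_T1p⟩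
    · rcases Nat.lt_or_ge tD 3 with htD1 | htD1
      · exact ⟨_, linkageX_of_caseOK caseOK_4_0_T22 (by decide) hz (by change (2:ℕ) = min 2 3; rfl) (by change (3:ℕ) = min sR 3; omega) (Or.inl (by change tD ≤ 2; omega)) (Or.inr (by decide)) (Or.inr (by decide)) (t1 := 2) (s1 := 3) (by omega) (by omega) (Or.inl (by omega)) (Or.inr (by norm_num)) wOK_4_0_T22⟩
      · exact ⟨_, linkageX_of_caseOK caseOK_4_0_T2p (by decide) hz (by change (2:ℕ) = min 2 3; rfl) (by change (3:ℕ) = min sR 3; omega) (Or.inr (by decide)) (Or.inr (by decide)) (Or.inr (by decide)) (t1 := 3) (s1 := 3) (by omega) (by omega) (Or.inr (by norm_num)) (Or.inr (by norm_num)) wOK_4_0_T2p⟩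
  · rcases Nat.lt_or_ge sR 3 with hsR3 | hsR3
    · interval_cases sR
      · rcases Nat.lt_or_ge sD 1 with hsD1 | hsD1
        · exact ⟨_, linkageX_of_caseOK caseOK_4_0_S00 (by decide) hz (by change (3:ℕ) = min tR 3; omega) (by change (0:ℕ) = min 0 3; rfl) (Or.inr (by decide)) (Or.inl (by change 0 ≤ 0; exact le_rfl)) (Or.inl (by change sD ≤ 0; omega)) (t1 := 3) (s1 := 0) (by omega) (by omega) (Or.inr (by norm_num)) (Or.inl (by omega)) wOK_4_0_S00⟩
        · exact ⟨_, linkageX_of_caseOK caseOK_4_0_S0p (by decide) hz (by change (3:ℕ) = min tR 3; omega) (by change (0:ℕ) = min 0 3; rfl) (Or.inr (by decide)) (Or.inl (by change 0 ≤ 0; exact le_rfl)) (Or.inr (by decide)) (t1 := 3) (s1 := 1) (by omega) (by omega) (Or.inr (by norm_num)) (Or.inr (by norm_num)) wOK_4_0_S0p⟩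
      · rcases Nat.lt_or_ge sD 2 with hsD1 | hsD1
        · exact ⟨_, linkageX_of_caseOK caseOK_4_0_S11 (by decide) hz (by change (3:ℕ) = min tR 3; omega) (by change (1:ℕ) = min 1 3; rfl) (Or.inr (by decide)) (Or.inl (by change 1 ≤ 1; exact le_rfl)) (Or.inl (by change sD ≤ 1; omega)) (t1 := 3) (s1 := 1) (by omega) (by omega) (Or.inr (by norm_num)) (Or.inl (by omega)) wOK_4_0_S11⟩
        · exact ⟨_, linkageX_of_caseOK caseOK_4_0_S1p (by decide) hz (by change (3:ℕ) = min tR 3; omega) (by change (1:ℕ) = min 1 3; rfl) (Or.inr (by decide)) (Or.inl (by change 1 ≤ 1; exact le_rfl)) (Or.inr (by decide)) (t1 := 3) (s1 := 2) (by omega) (by omega) (Or.inr (by norm_num)) (Or.inr (by norm_num)) wOK_4_0_S1p⟩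
      · rcases Nat.lt_or_ge sD 3 with hsD1 | hsD1
        · exact ⟨_, linkageX_of_caseOK caseOK_4_0_S22 (by decide) hz (by change (3:ℕ) = min tR 3; omega) (by change (2:ℕ) = min 2 3; rfl) (Or.inr (by decide)) (Or.inl (by change 2 ≤ 2; exact le_rfl)) (Or.inl (by change sD ≤ 2; omega)) (t1 := 3) (s1 := 2) (by omega) (by omega) (Or.inr (by norm_num)) (Or.inl (by omega)) wOK_4_0_S22⟩
        · exact ⟨_, linkageX_of_caseOK caseOK_4_0_S2p (by decide) hz (by change (3:ℕ) = min tR 3; omega) (by change (2:ℕ) = min 2 3; rfl) (Or.inr (by decide)) (Or.inl (by change 2 ≤ 2; exact le_rfl)) (Or.inr (by decide)) (t1 := 3) (s1 := 3) (by omega) (by omega) (Or.inr (by norm_num)) (Or.inr (by norm_num)) wOK_4_0_S2p⟩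
    · exact ⟨_, linkageX_of_caseOK caseOK_4_0_U (by decide) hz (by change (3:ℕ) = min tR 3; omega) (by change (3:ℕ) = min sR 3; omega) (Or.inr (by decide)) (Or.inr (by decide)) (Or.inr (by decide)) (t1 := 3) (s1 := 3) (by omega) (by omega) (Or.inr (by norm_num)) (Or.inr (by norm_num)) wOK_4_0_U⟩

/-- The exit-form node clause at every block of centre class `1` of `F_4(bcc)`, by block shape (13 covered cases). [cite: DuminilCopinSidoraviciusTassion2016, §2.3 (proof of Fact 2)] -/
theorem linkageX_4_1 (z : Site 2) (hz : (3 : ℤ) ∣ z 0 + 2 * z 1 - ((1 : ℕ) : ℤ)) (tR tD sR sD : ℕ) (htD : tR ≤ tD) (hsD : sR ≤ sD)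
    (hone : 3 ≤ tR ∨ 3 ≤ sR) :
    ∃ W : Set (bfilm 4), (∀ x ∈ W, (Bcc111.hexShadow 4).sh x ∈ blkR 3 z tD sD) ∧
      (∀ x, (Bcc111.hexShadow 4).sh x ∈ hexBall z 1 → (Bcc111.hexShadow 4).sh x ∈ blkR 3 z tD sD → x ∈ W) ∧
        ∀ (E₁ E₂ w' : bfilm 4), (Bcc111.hexShadow 4).TerminalsX 3 z tR tD sR sD W E₁ E₂ w' →
          ∃ r₁ r₂ : VRouteData (Bcc111.film 4) (W ∩ (Bcc111.hexShadow 4).lift (blkR 3 z tR sR)) W E₁ E₂ w', r₁.y = r₂.b ∧ r₁.b = r₂.y := by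
  rcases Nat.lt_or_ge tR 3 with htR3 | htR3
  · have hsR3 : 3 ≤ sR := by omega
    interval_cases tR
    · rcases Nat.lt_or_ge tD 1 with htD1 | htD1
      · exact ⟨_, linkageX_of_caseOK caseOK_4_1_T00 (by decide) hz (by change (0:ℕ) = min 0 3; rfl) (by change (3:ℕ) = min sR 3; omega) (Or.inl (by change tD ≤ 0; omega)) (Or.inr (by decide)) (Or.inr (by decide)) (t1 := 0) (s1 := 3) (by omega) (by omega) (Or.inl (by omega)) (Or.inr (by norm_num)) wOK_4_1_T00⟩
      · exact ⟨_, linkageX_of_caseOK caseOK_4_1_T0p (by decide) hz (by change (0:ℕ) = min 0 3; rfl) (by change (3:ℕ) = min sR 3; omega) (Or.inr (by decide)) (Or.inr (by decide)) (Or.inr (by decide)) (t1 := 1) (s1 := 3) (by omega) (by omega) (Or.inr (by norm_num)) (Or.inr (by norm_num)) wOK_4_1_T0p⟩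
    · rcases Nat.lt_or_ge tD 2 with htD1 | htD1
      · exact ⟨_, linkageX_of_caseOK caseOK_4_1_T11 (by decide) hz (by change (1:ℕ) = min 1 3; rfl) (by change (3:ℕ) = min sR 3; omega) (Or.inl (by change tD ≤ 1; omega)) (Or.inr (by decide)) (Or.inr (by decide)) (t1 := 1) (s1 := 3) (by omega) (by omega) (Or.inl (by omega)) (Or.inr (by norm_num)) wOK_4_1_T11⟩
      · exact ⟨_, linkageX_of_caseOK caseOK_4_1_T1p (by decide) hz (by change (1:ℕ) = min 1 3; rfl) (by change (3:ℕ) = min sR 3; omega) (Or.inr (by decide)) (Or.inr (by decide)) (Or.inr (by decide)) (t1 := 2) (s1 := 3) (by omega) (by omega) (Or.inr (by norm_num)) (Or.inr (by norm_num)) wOK_4_1_T1p⟩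
    · rcases Nat.lt_or_ge tD 3 with htD1 | htD1
      · exact ⟨_, linkageX_of_caseOK caseOK_4_1_T22 (by decide) hz (by change (2:ℕ) = min 2 3; rfl) (by change (3:ℕ) = min sR 3; omega) (Or.inl (by change tD ≤ 2; omega)) (Or.inr (by decide)) (Or.inr (by decide)) (t1 := 2) (s1 := 3) (by omega) (by omega) (Or.inl (by omega)) (Or.inr (by norm_num)) wOK_4_1_T22⟩
      · exact ⟨_, linkageX_of_caseOK caseOK_4_1_T2p (by decide) hz (by change (2:ℕ) = min 2 3; rfl) (by change (3:ℕ) = min sR 3; omega) (Or.inr (by decide)) (Or.inr (by decide)) (Or.inr (by decide)) (t1 := 3) (s1 := 3) (by omega) (by omega) (Or.inr (by norm_num)) (Or.inr (by norm_num)) wOK_4_1_T2p⟩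
  · rcases Nat.lt_or_ge sR 3 with hsR3 | hsR3
    · interval_cases sR
      · rcases Nat.lt_or_ge sD 1 with hsD1 | hsD1
        · exact ⟨_, linkageX_of_caseOK caseOK_4_1_S00 (by decide) hz (by change (3:ℕ) = min tR 3; omega) (by change (0:ℕ) = min 0 3; rfl) (Or.inr (by decide)) (Or.inl (by change 0 ≤ 0; exact le_rfl)) (Or.inl (by change sD ≤ 0; omega)) (t1 := 3) (s1 := 0) (by omega) (by omega) (Or.inr (by norm_num)) (Or.inl (by omega)) wOK_4_1_S00⟩
        · exact ⟨_, linkageX_of_caseOK caseOK_4_1_S0p (by decide) hz (by change (3:ℕ) = min tR 3; omega) (by change (0:ℕ) = min 0 3; rfl) (Or.inr (by decide)) (Or.inl (by change 0 ≤ 0; exact le_rfl)) (Or.inr (by decide)) (t1 := 3) (s1 := 1) (by omega) (by omega) (Or.inr (by norm_num)) (Or.inr (by norm_num)) wOK_4_1_S0p⟩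
      · rcases Nat.lt_or_ge sD 2 with hsD1 | hsD1
        · exact ⟨_, linkageX_of_caseOK caseOK_4_1_S11 (by decide) hz (by change (3:ℕ) = min tR 3; omega) (by change (1:ℕ) = min 1 3; rfl) (Or.inr (by decide)) (Or.inl (by change 1 ≤ 1; exact le_rfl)) (Or.inl (by change sD ≤ 1; omega)) (t1 := 3) (s1 := 1) (by omega) (by omega) (Or.inr (by norm_num)) (Or.inl (by omega)) wOK_4_1_S11⟩
        · exact ⟨_, linkageX_of_caseOK caseOK_4_1_S1p (by decide) hz (by change (3:ℕ) = min tR 3; omega) (by change (1:ℕ) = min 1 3; rfl) (Or.inr (by decide)) (Or.inl (by change 1 ≤ 1; exact le_rfl)) (Or.inr (by decide)) (t1 := 3) (s1 := 2) (by omega) (by omega) (Or.inr (by norm_num)) (Or.inr (by norm_num)) wOK_4_1_S1p⟩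
      · rcases Nat.lt_or_ge sD 3 with hsD1 | hsD1
        · exact ⟨_, linkageX_of_caseOK caseOK_4_1_S22 (by decide) hz (by change (3:ℕ) = min tR 3; omega) (by change (2:ℕ) = min 2 3; rfl) (Or.inr (by decide)) (Or.inl (by change 2 ≤ 2; exact le_rfl)) (Or.inl (by change sD ≤ 2; omega)) (t1 := 3) (s1 := 2) (by omega) (by omega) (Or.inr (by norm_num)) (Or.inl (by omega)) wOK_4_1_S22⟩
        · exact ⟨_, linkageX_of_caseOK caseOK_4_1_S2p (by decide) hz (by change (3:ℕ) = min tR 3; omega) (by change (2:ℕ) = min 2 3; rfl) (Or.inr (by decide)) (Or.inl (by change 2 ≤ 2; exact le_rfl)) (Or.inr (by decide)) (t1 := 3) (s1 := 3) (by omega) (by omega) (Or.inr (by norm_num)) (Or.inr (by norm_num)) wOK_4_1_S2p⟩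
    · exact ⟨_, linkageX_of_caseOK caseOK_4_1_U (by decide) hz (by change (3:ℕ) = min tR 3; omega) (by change (3:ℕ) = min sR 3; omega) (Or.inr (by decide)) (Or.inr (by decide)) (Or.inr (by decide)) (t1 := 3) (s1 := 3) (by omega) (by omega) (Or.inr (by norm_num)) (Or.inr (by norm_num)) wOK_4_1_U⟩

/-- The exit-form node clause at every block of centre class `2` of `F_4(bcc)`, by block shape (13 covered cases). [cite: DuminilCopinSidoraviciusTassion2016, §2.3 (proof of Fact 2)] -/
theorem linkageX_4_2 (z : Site 2) (hz : (3 : ℤ) ∣ z 0 + 2 * z 1 - ((2 : ℕ) : ℤ)) (tR tD sR sD : ℕ) (htD : tR ≤ tD) (hsD : sR ≤ sD)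
    (hone : 3 ≤ tR ∨ 3 ≤ sR) :
    ∃ W : Set (bfilm 4), (∀ x ∈ W, (Bcc111.hexShadow 4).sh x ∈ blkR 3 z tD sD) ∧
      (∀ x, (Bcc111.hexShadow 4).sh x ∈ hexBall z 1 → (Bcc111.hexShadow 4).sh x ∈ blkR 3 z tD sD → x ∈ W) ∧
        ∀ (E₁ E₂ w' : bfilm 4), (Bcc111.hexShadow 4).TerminalsX 3 z tR tD sR sD W E₁ E₂ w' →
          ∃ r₁ r₂ : VRouteData (Bcc111.film 4) (W ∩ (Bcc111.hexShadow 4).lift (blkR 3 z tR sR)) W E₁ E₂ w', r₁.y = r₂.b ∧ r₁.b = r₂.y := by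
  rcases Nat.lt_or_ge tR 3 with htR3 | htR3
  · have hsR3 : 3 ≤ sR := by omega
    interval_cases tR
    · rcases Nat.lt_or_ge tD 1 with htD1 | htD1
      · exact ⟨_, linkageX_of_caseOK caseOK_4_2_T00 (by decide) hz (by change (0:ℕ) = min 0 3; rfl) (by change (3:ℕ) = min sR 3; omega) (Or.inl (by change tD ≤ 0; omega)) (Or.inr (by decide)) (Or.inr (by decide)) (t1 := 0) (s1 := 3) (by omega) (by omega) (Or.inl (by omega)) (Or.inr (by norm_num)) wOK_4_2_T00⟩
      · exact ⟨_, linkageX_of_caseOK caseOK_4_2_T0p (by decide) hz (by change (0:ℕ) = min 0 3; rfl) (by change (3:ℕ) = min sR 3; omega) (Or.inr (by decide)) (Or.inr (by decide)) (Or.inr (by decide)) (t1 := 1) (s1 := 3) (by omega) (by omega) (Or.inr (by norm_num)) (Or.inr (by norm_num)) wOK_4_2_T0p⟩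
    · rcases Nat.lt_or_ge tD 2 with htD1 | htD1
      · exact ⟨_, linkageX_of_caseOK caseOK_4_2_T11 (by decide) hz (by change (1:ℕ) = min 1 3; rfl) (by change (3:ℕ) = min sR 3; omega) (Or.inl (by change tD ≤ 1; omega)) (Or.inr (by decide)) (Or.inr (by decide)) (t1 := 1) (s1 := 3) (by omega) (by omega) (Or.inl (by omega)) (Or.inr (by norm_num)) wOK_4_2_T11⟩
      · exact ⟨_, linkageX_of_caseOK caseOK_4_2_T1p (by decide) hz (by change (1:ℕ) = min 1 3; rfl) (by change (3:ℕ) = min sR 3; omega) (Or.inr (by decide)) (Or.inr (by decide)) (Or.inr (by decide)) (t1 := 2) (s1 := 3) (by omega) (by omega) (Or.inr (by norm_num)) (Or.inr (by norm_num)) wOK_4_2_T1p⟩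
    · rcases Nat.lt_or_ge tD 3 with htD1 | htD1
      · exact ⟨_, linkageX_of_caseOK caseOK_4_2_T22 (by decide) hz (by change (2:ℕ) = min 2 3; rfl) (by change (3:ℕ) = min sR 3; omega) (Or.inl (by change tD ≤ 2; omega)) (Or.inr (by decide)) (Or.inr (by decide)) (t1 := 2) (s1 := 3) (by omega) (by omega) (Or.inl (by omega)) (Or.inr (by norm_num)) wOK_4_2_T22⟩
      · exact ⟨_, linkageX_of_caseOK caseOK_4_2_T2p (by decide) hz (by change (2:ℕ) = min 2 3; rfl) (by change (3:ℕ) = min sR 3; omega) (Or.inr (by decide)) (Or.inr (by decide)) (Or.inr (by decide)) (t1 := 3) (s1 := 3) (by omega) (by omega) (Or.inr (by norm_num)) (Or.inr (by norm_num)) wOK_4_2_T2p⟩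
  · rcases Nat.lt_or_ge sR 3 with hsR3 | hsR3
    · interval_cases sR
      · rcases Nat.lt_or_ge sD 1 with hsD1 | hsD1
        · exact ⟨_, linkageX_of_caseOK caseOK_4_2_S00 (by decide) hz (by change (3:ℕ) = min tR 3; omega) (by change (0:ℕ) = min 0 3; rfl) (Or.inr (by decide)) (Or.inl (by change 0 ≤ 0; exact le_rfl)) (Or.inl (by change sD ≤ 0; omega)) (t1 := 3) (s1 := 0) (by omega) (by omega) (Or.inr (by norm_num)) (Or.inl (by omega)) wOK_4_2_S00⟩
        · exact ⟨_, linkageX_of_caseOK caseOK_4_2_S0p (by decide) hz (by change (3:ℕ) = min tR 3; omega) (by change (0:ℕ) = min 0 3; rfl) (Or.inr (by decide)) (Or.inl (by change 0 ≤ 0; exact le_rfl)) (Or.inr (by decide)) (t1 := 3) (s1 := 1) (by omega) (by omega) (Or.inr (by norm_num)) (Or.inr (by norm_num)) wOK_4_2_S0p⟩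
      · rcases Nat.lt_or_ge sD 2 with hsD1 | hsD1
        · exact ⟨_, linkageX_of_caseOK caseOK_4_2_S11 (by decide) hz (by change (3:ℕ) = min tR 3; omega) (by change (1:ℕ) = min 1 3; rfl) (Or.inr (by decide)) (Or.inl (by change 1 ≤ 1; exact le_rfl)) (Or.inl (by change sD ≤ 1; omega)) (t1 := 3) (s1 := 1) (by omega) (by omega) (Or.inr (by norm_num)) (Or.inl (by omega)) wOK_4_2_S11⟩
        · exact ⟨_, linkageX_of_caseOK caseOK_4_2_S1p (by decide) hz (by change (3:ℕ) = min tR 3; omega) (by change (1:ℕ) = min 1 3; rfl) (Or.inr (by decide)) (Or.inl (by change 1 ≤ 1; exact le_rfl)) (Or.inr (by decide)) (t1 := 3) (s1 := 2) (by omega) (by omega) (Or.inr (by norm_num)) (Or.inr (by norm_num)) wOK_4_2_S1p⟩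
      · rcases Nat.lt_or_ge sD 3 with hsD1 | hsD1
        · exact ⟨_, linkageX_of_caseOK caseOK_4_2_S22 (by decide) hz (by change (3:ℕ) = min tR 3; omega) (by change (2:ℕ) = min 2 3; rfl) (Or.inr (by decide)) (Or.inl (by change 2 ≤ 2; exact le_rfl)) (Or.inl (by change sD ≤ 2; omega)) (t1 := 3) (s1 := 2) (by omega) (by omega) (Or.inr (by norm_num)) (Or.inl (by omega)) wOK_4_2_S22⟩
        · exact ⟨_, linkageX_of_caseOK caseOK_4_2_S2p (by decide) hz (by change (3:ℕ) = min tR 3; omega) (by change (2:ℕ) = min 2 3; rfl) (Or.inr (by decide)) (Or.inl (by change 2 ≤ 2; exact le_rfl)) (Or.inr (by decide)) (t1 := 3) (s1 := 3) (by omega) (by omega) (Or.inr (by norm_num)) (Or.inr (by norm_num)) wOK_4_2_S2p⟩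
    · exact ⟨_, linkageX_of_caseOK caseOK_4_2_U (by decide) hz (by change (3:ℕ) = min tR 3; omega) (by change (3:ℕ) = min sR 3; omega) (Or.inr (by decide)) (Or.inr (by decide)) (Or.inr (by decide)) (t1 := 3) (s1 := 3) (by omega) (by omega) (Or.inr (by norm_num)) (Or.inr (by norm_num)) wOK_4_2_U⟩

end Bcc111.SK

namespace Bcc111

/-- **THE EXIT-FORM ROUTING CERTIFICATE OF THE bcc (111)-FILM OF THICKNESS `4`, surgery radius `3`** — kernel-certified swap pairs in every clipped block
(«Bcc111SKDefs» … «Bcc111SKCase», certificates «Bcc111SKc4··»).  Independent of p205010. [cite: DuminilCopinSidoraviciusTassion2016, §2.3 (proof of Fact 2)] -/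
theorem shapedLinkageX_three_m4 : (hexShadow 4).ShapedLinkageX 3 := by
  intro z tR tD sR sD htD hsD hone
  have hcls : (3 : ℤ) ∣ z 0 + 2 * z 1 - ((0 : ℕ) : ℤ) ∨ (3 : ℤ) ∣ z 0 + 2 * z 1 - ((1 : ℕ) : ℤ) ∨ (3 : ℤ) ∣ z 0 + 2 * z 1 - ((2 : ℕ) : ℤ) := by
    push_cast; omega
  rcases hcls with hz | hz | hz
  · exact SK.linkageX_4_0 z hz tR tD sR sD htD hsD hone
  · exact SK.linkageX_4_1 z hz tR tD sR sD htD hsD hone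
  · exact SK.linkageX_4_2 z hz tR tD sR sD htD hsD hone

/-- **THE bcc (111)-FILM OF THICKNESS `4` AT ITS OWN CRITICAL POINT: `θ_{F_4(bcc)}(v, p_c(F_4(bcc))) = 0` for every vertex `v`** — UNCONDITIONAL and
p205010-free: Duminil-Copin–Sidoravicius–Tassion's argument transplanted through the hexagonal shadow («HexShadow*», «Bcc111Film*»), the exit-form routing
«HexShadowVRoutingX», and the kernel-certified swap-pair plans of this chain.
[cite: DuminilCopinSidoraviciusTassion2016, Thm. 1 and §2] [cite: BenjaminiSchramm1996, Conj. 4 / Question 3] [cite: ConwaySloane1999, Ch. 4 §7.1] -/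
theorem theta_criticalProb_eq_zero_m4 (v : bfilm 4) : theta (film 4) v (criticalProbIOf (film 4) v) = 0 :=
  theta_criticalProb_eq_zero_of_shapedLinkageX (m := 4) (by norm_num) (by norm_num : (1 : ℕ) ≤ 3) shapedLinkageX_three_m4 v

end Bcc111

end Summit.CriticalPhenomena.PercolationContinuityZ3.Theorems.Transplant

end
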